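import Literature.MathematicalPhysics.QuantumLattice.HubbardTTPrimeDiagonalUAnchors
import HarnessLib

/-!
# The `U`-dressed third-neighbour (`t''`) transport law: the doubling map `x ↦ 2x` reads the pure-`t''`
# Hubbard model WITH its repulsion as the nearest-neighbour Hubbard model, so every certified `t' = 0`
# row `ℓ_V ≤ e(1, 0, V, n)` prices a unit of `|t''|` at `|ℓ_V|` instead of the kinematic `16/π²`

Topic `Literature/MathematicalPhysics/QuantumLattice` (family `hubbard`). Companion of
`InfVolFermionStateLatticeMapPullback` (§5–§7: the doubling bond identity for the HOPPING part,
`K₁(ω ∘ Γ_{2·}) = K₃(ω)`, and the `t''`-transport of the certified `t–t'` density at the KINEMATIC constant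
`(16/π²)|t''|`), `HubbardTTPrimeTPPKinematicLipschitz` (its Lipschitz form, consumed by the `S1/S2` seam of the
Hubbard material-oracle programme: every object-M = `t–t'–t''` word of `pub/hubbard-downfold` carries the
allowance `(16/π²)·max|t''/t|` per side, e.g. `±0.291` on `boxCCOCM_M36`) and `HubbardTTPrimeDiagonalUAnchors`
(the same dressing for the DIAGONAL hopping `t'` through the checkerboard map). Written by the S2 seat
`hubbard-box-p3` («`t'`-direction Lipschitz / perturbative remainder bound», 2026-08-28).

The point: the doubling map fixes the origin, so it carries the on-site repulsion onto itself
(`meanEnergy_onSite_mapAct_doubling`); hence the pulled-back state `ω ∘ Γ_{2·}` has, in the nearest-neighbour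
model `Φ(s, 0, W)`, the mean energy `s·K₃(ω) + W·D(ω)` (`meanEnergy_mapAct_doubling`) — the pure third-neighbour
Hubbard interaction `Φ(0,0,s,W)` read through the doubling map IS the nearest-neighbour Hubbard interaction
(`meanEnergy_mapAct_doubling_eq_tpp`). Consequences, all PROVED (no definition, no named fact, no number, no `sorry`):

* §1 the identities above and the `U`-SPLIT `e^{tt't''}_{(t,t',s,U)}(ω) = e^{tt'}_{(t,t',U−W)}(ω) + e^{Φ(s,0,W)}(ω ∘ Γ_{2·})`.
* §2 **DRESSED `K₃` BRACKETS for every translation-invariant state** `σ` of filling `ρ ∈ (0,2)`: for `V ≥ 0` and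
  every certified row `ℓ ≤ e(1, 0, V, ρ)`,
  `|s|ℓ − |s|V·D(σ) ≤ s·K₃(σ) ≤ |s|V·D(σ) − |s|ℓ` (`V = 0`: the density-sharp kinematic bracket `|s·K₃(σ)| ≤ |s|·|ℓ₀|`
  from any certified FREE floor `ℓ₀ ≤ e(1,0,0,ρ)`, never worse than `16/π²`).
* §3 **DRESSED OBJECT-M FLOOR**: `e(t,t',U − |s|V, ρ) + |s|·e(1,0,V,ρ) ≤ e_ρ(t,t',s,U)` (`0 ≤ |s|V ≤ U`) — a certified
  `t–t'` floor read `|s|V` LOWER in `U` plus `|s|` times a certified `t' = 0` row at coupling `V`; anchor and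
  `t''`-interval forms.
* §4 **DRESSED OBJECT-M CAP**: a `t–t'` cap `R` at `(t,t',U,ρ)` and a double-occupancy ceiling `D` for the torus-limit
  ground states there give `e_ρ(t,t',s,U) ≤ R + |s|(V·D − ℓ)`; the data-free instance `D = (R − L')/(U − U')` from a floor
  `L'` at a smaller coupling `U'` (supergradient chord).
* §5 the two-sided window and the BOX form (constant `t–t'` cell word on `[U_a, ·] × [s₁,s₂] × [n₁,n₂]` ⇒ object-M word
  on `[U₁,U₂] × [s₁,s₂] × [p₁,p₂] × [n₁,n₂]` with `U_a + max(|p₁|,|p₂|)·V ≤ U₁`), in the `tiGroundEnergyDensityAt … ` grammar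
  of `tiGroundEnergyDensityAt_tpp_mem_Icc_kinematic` (the seam's input shape).

HONEST SCOPE: zeroth-order energy bookkeeping for the `t''` truncation; the floor dressing trades the kinematic
price `1.62|t''|` for `|ℓ_V|·|t''|` (`≈ 0.84|t''|` at `V = 8`, `1.10|t''|` at `V = 4`, filling `7/8`) against reading
the `t–t'` floor `|t''|V` lower in `U`; the cap dressing pays only with a certified double-occupancy ceiling well
below `(n/2)²`. Nothing here is an order / pairing / `T_c` statement.

## Mathlib / tree search

REUSED: `mapAct`, `mapAct_expect`, `IsTranslationInvariant.mapAct`, `density_mapAct`, `doubling`,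
`meanEnergy_nnHop_mapAct_doubling` (`InfVolFermionStateLatticeMapPullback`); `fermionEmbed_nAt_of_apply_eq`;
`meanEnergy_hubbardTTPrime_onSite_eq_re_expect_docc`; `meanEnergy_hubbardTTPrime_eq_coords / _affine / _eq_one`;
`meanEnergy_hubbardTT'T''`; `le_tiGroundEnergyDensityAt / tiGroundEnergyDensityAt_le_meanEnergy`;
`energyDensityTT'_le_meanEnergy_of_isTranslationInvariant`; `exists_isTorusLimitOf_meanEnergy_hubbardTTPrime_eq`;
`energyDensityTT'_abs_t / _smul / _anchor_le`. `lean search 'doubling|axialRange2|tpp.*diagU|mapAct.*onSite'`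
(2026-08-28): only the kinematic `t''` rows (`LatticeMapPullback` §6–§7, `TPPKinematicLipschitz`, `TPPVariationalPressure`).

## References

* E. Pavarini et al., PRL 87 (2001) 047003, eq. (1) (the `t–t'–t''` one-band model). [cite: PavariniEtAl2001, eq. (1)]
* D. Ruelle, *Statistical Mechanics: Rigorous Results* (1969), §3.3–§3.4. [cite: Ruelle1969, §3.4]
* O. Bratteli, D. W. Robinson, *OAQSM 1* (1987), §4.3.1. [cite: BratteliRobinsonI1987, §4.3.1]
* R. B. Griffiths, J. Math. Phys. 5 (1964) 1215, §II (variational bounds along a one-parameter family). [cite: Griffiths1966, §II]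
-/

noncomputable section

namespace Literature.MathematicalPhysics.QuantumLattice

open Matrix Finset HubbardWave0 Literature.Probability.LatticeModels ThermodynamicLimit
open _root_.Filter
open scoped _root_.Topology ComplexOrder BigOperators

/-! ### §1. The doubling identity with repulsion -/

namespace InfVolFermionState

/-- **The on-site repulsion is carried onto itself by the doubling map** (`2·0 = 0`): the double-occupancy
density of `ω ∘ Γ_{2·}` is that of `ω`, `D(ω ∘ Γ_{2·}) = D(ω)`. [cite: BratteliRobinsonI1987, §4.3.1] -/
theorem meanEnergy_onSite_mapAct_doubling (ω : InfVolFermionState 2) :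
    (ω.mapAct (doubling 2) doubling_injective).meanEnergy (hubbardTTPrimeFermionInteraction 0 0 1) 1 =
      ω.meanEnergy (hubbardTTPrimeFermionInteraction 0 0 1) 1 := by
  rw [meanEnergy_hubbardTTPrime_onSite_eq_re_expect_docc, meanEnergy_hubbardTTPrime_onSite_eq_re_expect_docc,
    mapAct_expect]
  have hmem : (0 : Site 2) ∈ mapSet (doubling 2) ({0} : Finset (Site 2)) := by
    have h := mem_mapSet_of_mem (doubling 2) (mem_singleton_self (0 : Site 2))
    rwa [map_zero] at h
  have hsub : ({0} : Finset (Site 2)) ⊆ mapSet (doubling 2) ({0} : Finset (Site 2)) :=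
    singleton_subset_iff.2 hmem
  have hn : ∀ σ : Fin 2,
      fermionEmbed (PolySite.mapEmb (doubling 2) doubling_injective ({0} : Finset (Site 2)))
          (nAt (0 : Site 2) (mem_singleton_self 0) σ) =
        fermionEmbed (PolySite.incl hsub) (nAt (0 : Site 2) (mem_singleton_self 0) σ) := by
    intro σ
    rw [fermionEmbed_nAt_of_apply_eq _ (mem_singleton_self 0) hmem (by simp) σ,
      fermionEmbed_nAt_of_apply_eq _ (mem_singleton_self 0) hmem (by simp) σ]
  rw [map_mul, hn 0, hn 1, ← map_mul, ω.compatible hsub]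

/-- **THE DOUBLING IDENTITY WITH REPULSION.** For every infinite-volume state `ω` on `ℤ²` and all `s, W`:
`e_{Φ(s,0,W)}(ω ∘ Γ_{2·}) = s·K₃(ω) + W·D(ω)` — the nearest-neighbour Hubbard mean energy of the pulled-back
state is the third-neighbour hopping density of `ω` times `s` plus its double occupancy times `W`.
[cite: PavariniEtAl2001, eq. (1)] -/
theorem meanEnergy_mapAct_doubling (ω : InfVolFermionState 2) (s W : ℝ) :
    (ω.mapAct (doubling 2) doubling_injective).meanEnergy (hubbardTTPrimeFermionInteraction s 0 W) 1 =
      s * ω.meanEnergy (axialRange2HoppingFermionInteraction 2 1) 2 +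
        W * ω.meanEnergy (hubbardTTPrimeFermionInteraction 0 0 1) 1 := by
  rw [meanEnergy_hubbardTTPrime_eq_coords, meanEnergy_nnHop_mapAct_doubling, meanEnergy_onSite_mapAct_doubling,
    zero_mul, add_zero]

/-- **The pure third-neighbour Hubbard interaction read through the doubling map is the nearest-neighbour
Hubbard interaction**: `e_{Φ(s,0,W)}(ω ∘ Γ_{2·}) = e_{Φ(0,0,s,W)}(ω)` (range parameter `2` on the right).
[cite: PavariniEtAl2001, eq. (1)] -/
theorem meanEnergy_mapAct_doubling_eq_tpp (ω : InfVolFermionState 2) (s W : ℝ) :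
    (ω.mapAct (doubling 2) doubling_injective).meanEnergy (hubbardTTPrimeFermionInteraction s 0 W) 1 =
      ω.meanEnergy (hubbardTT'T''FermionInteraction 0 0 s W) 2 := by
  rw [meanEnergy_mapAct_doubling, meanEnergy_hubbardTT'T'' 0 0 s W ω 2,
    ω.meanEnergy_hubbardTTPrime_eq_one 0 0 W (by norm_num : (1 : ℝ) ≤ 2)]
  rw [ω.meanEnergy_hubbardTTPrime_eq_coords 0 0 W]
  ring

/-- **THE `U`-SPLIT.** For every state `ω` and all `t, t', s, U, W`:
`e_{(t,t',s,U)}(ω) = e_{Φ(t,t',U−W)}(ω) + e_{Φ(s,0,W)}(ω ∘ Γ_{2·})` — the `t–t'–t''` mean energy at coupling `U`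
is the `t–t'` mean energy at the LOWER coupling `U − W` plus the nearest-neighbour `(s, W)` mean energy of the
pulled-back state. [cite: PavariniEtAl2001, eq. (1)] -/
theorem meanEnergy_hubbardTT'T''_eq_add_mapAct_doubling (ω : InfVolFermionState 2) (t t' s U W : ℝ) :
    ω.meanEnergy (hubbardTT'T''FermionInteraction t t' s U) 2 =
      ω.meanEnergy (hubbardTTPrimeFermionInteraction t t' (U - W)) 1 +
        (ω.mapAct (doubling 2) doubling_injective).meanEnergy (hubbardTTPrimeFermionInteraction s 0 W) 1 := by
  rw [meanEnergy_mapAct_doubling, meanEnergy_hubbardTT'T'' t t' s U ω 2,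
    ω.meanEnergy_hubbardTTPrime_eq_one t t' U (by norm_num : (1 : ℝ) ≤ 2),
    ω.meanEnergy_hubbardTTPrime_affine t t' (U - W) t' U]
  ring

/-! ### §2. Dressed `K₃` brackets for every translation-invariant state -/

/-- **DRESSED LOWER `K₃` BRACKET.** For a translation-invariant `σ` of filling `0 < ρ(σ) < 2`, every real `s`
and every `V ≥ 0`: `|s|·e(1, 0, V, ρ(σ)) ≤ s·K₃(σ) + |s|V·D(σ)` — the variational principle for the
nearest-neighbour model `Φ(s, 0, |s|V)` at the pulled-back state `σ ∘ Γ_{2·}` (translation invariant, same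
filling), hopping-sign symmetry and homogeneity `e(s,0,|s|V) = |s|·e(1,0,V)`. [cite: Ruelle1969, §3.4] -/
theorem IsTranslationInvariant.abs_mul_energyDensityTT'_nn_le_tpp_add {σ : InfVolFermionState 2}
    (hσ : σ.IsTranslationInvariant) (hρ0 : 0 < σ.density) (hρ2 : σ.density < 2) (s : ℝ) {V : ℝ}
    (hV : 0 ≤ V) :
    |s| * energyDensityTT' 1 0 V σ.density ≤
      s * σ.meanEnergy (axialRange2HoppingFermionInteraction 2 1) 2 +
        |s| * V * σ.meanEnergy (hubbardTTPrimeFermionInteraction 0 0 1) 1 := by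
  have hsV : 0 ≤ |s| * V := mul_nonneg (abs_nonneg s) hV
  have hTI := hσ.mapAct (doubling 2) doubling_injective
  have hρ' : (σ.mapAct (doubling 2) doubling_injective).density = σ.density :=
    σ.density_mapAct (doubling 2) doubling_injective (map_zero _)
  have hvar := energyDensityTT'_le_meanEnergy_of_isTranslationInvariant s 0 hsV hρ0 hρ2 hTI hρ'
  rw [σ.meanEnergy_mapAct_doubling s (|s| * V)] at hvar
  have h2 : energyDensityTT' s 0 (|s| * V) σ.density = |s| * energyDensityTT' 1 0 V σ.density := by
    rw [← energyDensityTT'_abs_t s 0 hsV hρ0.le hρ2]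
    have h3 := energyDensityTT'_smul 1 0 hV hρ0.le hρ2 (abs_nonneg s)
    rw [mul_one, mul_zero] at h3
    exact h3
  rw [h2] at hvar
  exact hvar

/-- **DRESSED TWO-SIDED `K₃` BRACKET fed by a certified row.** For a translation-invariant `σ` of filling
`ρ ∈ (0,2)`, `V ≥ 0` and any certified `t' = 0` floor `ℓ ≤ e(1, 0, V, ρ)`:
`|s|ℓ − |s|V·D(σ) ≤ s·K₃(σ) ≤ |s|V·D(σ) − |s|ℓ`. At `V = 0` this is the density-sharp kinematic bracket
`|s·K₃(σ)| ≤ |s|·|ℓ₀|`; at `V > 0` the price per unit `|s|` is `|ℓ_V|` plus `V` times the double occupancy.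
[cite: Ruelle1969, §3.4] -/
theorem IsTranslationInvariant.mul_axialRange2Hopping_mem_Icc_diagU {σ : InfVolFermionState 2}
    (hσ : σ.IsTranslationInvariant) {ρ : ℝ} (hρ : σ.density = ρ) (hρ0 : 0 < ρ) (hρ2 : ρ < 2) (s : ℝ)
    {V : ℝ} (hV : 0 ≤ V) {ℓ : ℝ} (hℓ : ℓ ≤ energyDensityTT' 1 0 V ρ) :
    s * σ.meanEnergy (axialRange2HoppingFermionInteraction 2 1) 2 ∈
      Set.Icc (|s| * ℓ - |s| * V * σ.meanEnergy (hubbardTTPrimeFermionInteraction 0 0 1) 1)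
        (|s| * V * σ.meanEnergy (hubbardTTPrimeFermionInteraction 0 0 1) 1 - |s| * ℓ) := by
  subst hρ
  have hlo := hσ.abs_mul_energyDensityTT'_nn_le_tpp_add hρ0 hρ2 s hV
  have hhi := hσ.abs_mul_energyDensityTT'_nn_le_tpp_add hρ0 hρ2 (-s) hV
  rw [abs_neg] at hhi
  have hsℓ := mul_le_mul_of_nonneg_left hℓ (abs_nonneg s)
  constructor <;> nlinarith

/-- **Density-sharp kinematic `K₃` row** (the `V = 0` case): `|s·K₃(σ)| ≤ |s|·(−ℓ₀)` for every
translation-invariant `σ` of filling `ρ ∈ (0,2)` and every certified FREE floor `ℓ₀ ≤ e(1, 0, 0, ρ)` (e.g. a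
kernel Fermi-sea row; `ℓ₀ = −16/π²` recovers `IsTranslationInvariant.abs_meanEnergy_axialRange2Hopping_le`).
[cite: LiebLoss1993, §8, Theorem 8.2] -/
theorem IsTranslationInvariant.abs_mul_axialRange2Hopping_le_of_freeFloor {σ : InfVolFermionState 2}
    (hσ : σ.IsTranslationInvariant) {ρ : ℝ} (hρ : σ.density = ρ) (hρ0 : 0 < ρ) (hρ2 : ρ < 2) (s : ℝ)
    {ℓ₀ : ℝ} (hℓ : ℓ₀ ≤ energyDensityTT' 1 0 0 ρ) :
    |s * σ.meanEnergy (axialRange2HoppingFermionInteraction 2 1) 2| ≤ |s| * -ℓ₀ := by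
  have h := hσ.mul_axialRange2Hopping_mem_Icc_diagU hρ hρ0 hρ2 s le_rfl hℓ
  simp only [mul_zero, zero_mul, sub_zero, zero_sub] at h
  rw [abs_le]
  constructor <;> linarith [h.1, h.2]

end InfVolFermionState

/-! ### §3. The dressed object-M floor -/

/-- **DRESSED OBJECT-M FLOOR, `W`-form.** For `0 ≤ W ≤ U`, `0 < ρ < 2` and all `t, t', s`:
`e(t, t', U − W, ρ) + e(s, 0, W, ρ) ≤ e_ρ(t, t', s, U)` — superadditivity of the infimum under the `U`-split of
§1, the translation-invariant variational principle for the `t–t'` part, and the doubling floor for the pure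
third-neighbour part (its pulled-back states are translation invariant of the same filling). [cite: Ruelle1969, §3.4] -/
theorem energyDensityTT'_add_nn_le_tpp (t t' s : ℝ) {U W : ℝ} (hW : 0 ≤ W) (hWU : W ≤ U) {ρ : ℝ}
    (hρ0 : 0 < ρ) (hρ2 : ρ < 2) :
    energyDensityTT' t t' (U - W) ρ + energyDensityTT' s 0 W ρ ≤
      (hubbardTT'T''FermionInteraction t t' s U).tiGroundEnergyDensityAt 2 ρ := by
  refine FermionInteraction.le_tiGroundEnergyDensityAt _ 2 (exists_isTranslationInvariant_density_eq hρ0 hρ2)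
    fun σ hσ hρ => ?_
  rw [σ.meanEnergy_hubbardTT'T''_eq_add_mapAct_doubling t t' s U W]
  have h1 := InfVolFermionState.energyDensityTT'_le_meanEnergy_of_isTranslationInvariant t t'
    (sub_nonneg.2 hWU) hρ0 hρ2 hσ hρ
  have hTI := hσ.mapAct (doubling 2) doubling_injective
  have hρ' : (σ.mapAct (doubling 2) doubling_injective).density = ρ := by
    rw [σ.density_mapAct (doubling 2) doubling_injective (map_zero _), hρ]
  have h2 := InfVolFermionState.energyDensityTT'_le_meanEnergy_of_isTranslationInvariant s 0 hW hρ0 hρ2 hTI hρ'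
  linarith

/-- **DRESSED OBJECT-M FLOOR.** For `V ≥ 0` with `|s|V ≤ U`, `0 < ρ < 2`:
`e(t, t', U − |s|V, ρ) + |s|·e(1, 0, V, ρ) ≤ e_ρ(t, t', s, U)` — a unit of `|t''|` costs `|e(1,0,V,ρ)|` when the
`t–t'` floor is read `|t''|V` lower in `U` (`V = 0`: the density-sharp kinematic law). [cite: Ruelle1969, §3.4] -/
theorem energyDensityTT'_add_abs_mul_le_tpp (t t' s : ℝ) {U V : ℝ} (hV : 0 ≤ V) (hVU : |s| * V ≤ U) {ρ : ℝ}
    (hρ0 : 0 < ρ) (hρ2 : ρ < 2) :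
    energyDensityTT' t t' (U - |s| * V) ρ + |s| * energyDensityTT' 1 0 V ρ ≤
      (hubbardTT'T''FermionInteraction t t' s U).tiGroundEnergyDensityAt 2 ρ := by
  have hsV : 0 ≤ |s| * V := mul_nonneg (abs_nonneg s) hV
  have h := energyDensityTT'_add_nn_le_tpp t t' s hsV hVU hρ0 hρ2
  have h2 : energyDensityTT' s 0 (|s| * V) ρ = |s| * energyDensityTT' 1 0 V ρ := by
    rw [← energyDensityTT'_abs_t s 0 hsV hρ0.le hρ2]
    have h3 := energyDensityTT'_smul 1 0 hV hρ0.le hρ2 (abs_nonneg s)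
    rw [mul_one, mul_zero] at h3
    exact h3
  rw [h2] at h
  exact h

/-- **Fed form**: a certified `t–t'` floor `L ≤ e(t, t', U − |s|V, ρ)` and a certified `t' = 0` row
`ℓ ≤ e(1, 0, V, ρ)` give `L + |s|ℓ ≤ e_ρ(t, t', s, U)`. [cite: Ruelle1969, §3.4] -/
theorem le_tpp_of_floor_add_abs_mul (t t' s : ℝ) {U V : ℝ} (hV : 0 ≤ V) (hVU : |s| * V ≤ U) {ρ : ℝ}
    (hρ0 : 0 < ρ) (hρ2 : ρ < 2) {L ℓ : ℝ} (hL : L ≤ energyDensityTT' t t' (U - |s| * V) ρ)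
    (hℓ : ℓ ≤ energyDensityTT' 1 0 V ρ) :
    L + |s| * ℓ ≤ (hubbardTT'T''FermionInteraction t t' s U).tiGroundEnergyDensityAt 2 ρ := by
  have h := energyDensityTT'_add_abs_mul_le_tpp t t' s hV hVU hρ0 hρ2
  have hsℓ := mul_le_mul_of_nonneg_left hℓ (abs_nonneg s)
  linarith

/-- **Anchor form** (floors travel UP in `U`): a `t–t'` floor `L ≤ e(t, t', U_a, ρ)` at ANY coupling
`0 ≤ U_a ≤ U − |s|V` and a row `ℓ ≤ e(1, 0, V, ρ)` give `L + |s|ℓ ≤ e_ρ(t, t', s, U)`. [cite: Ruelle1969, §3.3] -/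
theorem le_tpp_of_anchorFloor_diagU (t t' s : ℝ) {U Ua V : ℝ} (hUa : 0 ≤ Ua) (hV : 0 ≤ V)
    (hUaU : Ua + |s| * V ≤ U) {ρ : ℝ} (hρ0 : 0 < ρ) (hρ2 : ρ < 2) {L ℓ : ℝ}
    (hL : L ≤ energyDensityTT' t t' Ua ρ) (hℓ : ℓ ≤ energyDensityTT' 1 0 V ρ) :
    L + |s| * ℓ ≤ (hubbardTT'T''FermionInteraction t t' s U).tiGroundEnergyDensityAt 2 ρ :=
  le_tpp_of_floor_add_abs_mul t t' s hV (by linarith) hρ0 hρ2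
    (energyDensityTT'_anchor_le t t' hρ0.le hρ2 hUa (by linarith) hL) hℓ

/-- **`t''`-INTERVAL form**: for `|s| ≤ m`, a NON-POSITIVE row `ℓ ≤ e(1, 0, V, ρ)` (`ℓ ≤ 0`) and a `t–t'` floor
`L ≤ e(t, t', U_a, ρ)` with `0 ≤ U_a`, `U_a + mV ≤ U`: `L + m·ℓ ≤ e_ρ(t, t', s, U)` — one allowance `m|ℓ|` for the
whole `t''`-range `|t''| ≤ m` of an object-M box. [cite: Ruelle1969, §3.3] -/
theorem le_tpp_of_anchorFloor_diagU_of_abs_le (t t' : ℝ) {s m U Ua V : ℝ} (hsm : |s| ≤ m) (hUa : 0 ≤ Ua)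
    (hV : 0 ≤ V) (hUaU : Ua + m * V ≤ U) {ρ : ℝ} (hρ0 : 0 < ρ) (hρ2 : ρ < 2) {L ℓ : ℝ}
    (hL : L ≤ energyDensityTT' t t' Ua ρ) (hℓ : ℓ ≤ energyDensityTT' 1 0 V ρ) (hℓ0 : ℓ ≤ 0) :
    L + m * ℓ ≤ (hubbardTT'T''FermionInteraction t t' s U).tiGroundEnergyDensityAt 2 ρ := by
  have hmV : |s| * V ≤ m * V := mul_le_mul_of_nonneg_right hsm hV
  have h := le_tpp_of_anchorFloor_diagU t t' s (U := U) hUa hV (by linarith) hρ0 hρ2 hL hℓ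
  have hmℓ : m * ℓ ≤ |s| * ℓ := mul_le_mul_of_nonpos_right hsm hℓ0
  linarith

/-! ### §4. The dressed object-M cap -/

/-- **DRESSED CAP, state form.** A translation-invariant `ω₀` of filling `ρ ∈ (0,2)` with `e^{tt'}(ω₀) ≤ u`
(range `1`) and double occupancy `D(ω₀) ≤ D`, a coupling `V ≥ 0` and a row `ℓ ≤ e(1, 0, V, ρ)` give, for every `s`:
`e_ρ(t, t', s, U) ≤ u + |s|·(V·D − ℓ)` (variational principle at `ω₀` + the dressed upper `K₃` bracket).
[cite: Griffiths1966, §II] -/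
theorem tpp_le_cap_add_abs_mul_diagU (t t' s U : ℝ) {ρ : ℝ} (hρ0 : 0 < ρ) (hρ2 : ρ < 2)
    {ω₀ : InfVolFermionState 2} (hω₀ : ω₀.IsTranslationInvariant) (hρ : ω₀.density = ρ) {u : ℝ}
    (hu : ω₀.meanEnergy (hubbardTTPrimeFermionInteraction t t' U) 1 ≤ u) {D : ℝ}
    (hD : ω₀.meanEnergy (hubbardTTPrimeFermionInteraction 0 0 1) 1 ≤ D) {V : ℝ} (hV : 0 ≤ V) {ℓ : ℝ}
    (hℓ : ℓ ≤ energyDensityTT' 1 0 V ρ) :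
    (hubbardTT'T''FermionInteraction t t' s U).tiGroundEnergyDensityAt 2 ρ ≤ u + |s| * (V * D - ℓ) := by
  have hvar := FermionInteraction.tiGroundEnergyDensityAt_le_meanEnergy (hubbardTT'T''FermionInteraction t t' s U)
    2 hω₀ hρ
  rw [InfVolFermionState.meanEnergy_hubbardTT'T'' t t' s U ω₀ 2,
    ω₀.meanEnergy_hubbardTTPrime_eq_one t t' U (by norm_num : (1 : ℝ) ≤ 2)] at hvar
  have hbr := (hω₀.mul_axialRange2Hopping_mem_Icc_diagU hρ hρ0 hρ2 s hV hℓ).2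
  have hsVD : |s| * V * ω₀.meanEnergy (hubbardTTPrimeFermionInteraction 0 0 1) 1 ≤ |s| * V * D :=
    mul_le_mul_of_nonneg_left hD (mul_nonneg (abs_nonneg s) hV)
  nlinarith

/-- **DRESSED CAP, ground-state-class form.** For `U ≥ 0`, `0 < ρ < 2`: a certified cap `e(t, t', U, ρ) ≤ R`,
a double-occupancy ceiling `D` certified for EVERY torus-limit ground state at `(t, t', U, ρ)` (the usual
`docc` word shape), `V ≥ 0` and a row `ℓ ≤ e(1, 0, V, ρ)` give `e_ρ(t, t', s, U) ≤ R + |s|·(V·D − ℓ)` for every `s`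
(the anchor state is Ruelle's minimising torus limit, which carries `e(t,t',U,ρ)` exactly). [cite: Griffiths1966, §II] -/
theorem tpp_le_cap_add_abs_mul_diagU_of_forall_docc (t t' s : ℝ) {U : ℝ} (hU : 0 ≤ U) {ρ : ℝ}
    (hρ0 : 0 < ρ) (hρ2 : ρ < 2) {R : ℝ} (hR : energyDensityTT' t t' U ρ ≤ R) {D : ℝ}
    (hD : ∀ (ω : InfVolFermionState 2) (Ls : ℕ → ℕ) (ψ : ∀ L, Fock (Orb (FermionTorus 2 L))),
      Tendsto Ls atTop atTop →
      (∀ j, IsGroundStateInSector (hubbardTorusTT' (Ls j) t t' U) (rectN ρ (Ls j)) 0 (ψ (Ls j))) →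
      (∀ j, star (ψ (Ls j)) ⬝ᵥ ψ (Ls j) = 1) → ω.IsTorusLimitOf ψ Ls →
      ω.meanEnergy (hubbardTTPrimeFermionInteraction 0 0 1) 1 ≤ D)
    {V : ℝ} (hV : 0 ≤ V) {ℓ : ℝ} (hℓ : ℓ ≤ energyDensityTT' 1 0 V ρ) :
    (hubbardTT'T''FermionInteraction t t' s U).tiGroundEnergyDensityAt 2 ρ ≤ R + |s| * (V * D - ℓ) := by
  obtain ⟨ψ, φ, ω, hφ, hψ, hψ1, hω, hTI, -, hdens, he⟩ :=
    exists_isTorusLimitOf_meanEnergy_hubbardTTPrime_eq t t' hU hρ0.le hρ2 tendsto_id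
  have hLs : Tendsto (id ∘ φ) atTop atTop := tendsto_id.comp hφ.tendsto_atTop
  have hDω := hD ω (id ∘ φ) ψ hLs (fun j => hψ _) (fun j => hψ1 _) hω
  exact tpp_le_cap_add_abs_mul_diagU t t' s U hρ0 hρ2 hTI hdens (by rw [he]; exact hR) hDω hV hℓ

/-- **DRESSED CAP, data-free chord instance.** A cap `e(t, t', U, ρ) ≤ R` and a floor `L' ≤ e(t, t', U', ρ)` at a
SMALLER coupling `0 ≤ U' < U` bound the double occupancy of the minimising torus limit at `U` by the supergradient
chord `(R − L')/(U − U')`, hence `e_ρ(t, t', s, U) ≤ R + |s|·(V·(R − L')/(U − U') − ℓ)` for `V ≥ 0`,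
`ℓ ≤ e(1, 0, V, ρ)`. (Useful only when the two energy rows are tight; a certified `docc` word is the better
input.) [cite: Griffiths1966, §II] -/
theorem tpp_le_cap_add_abs_mul_diagU_chord (t t' s : ℝ) {U U' : ℝ} (hU' : 0 ≤ U') (hU'U : U' < U) {ρ : ℝ}
    (hρ0 : 0 < ρ) (hρ2 : ρ < 2) {R L' : ℝ} (hR : energyDensityTT' t t' U ρ ≤ R)
    (hL' : L' ≤ energyDensityTT' t t' U' ρ) {V : ℝ} (hV : 0 ≤ V) {ℓ : ℝ} (hℓ : ℓ ≤ energyDensityTT' 1 0 V ρ) :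
    (hubbardTT'T''FermionInteraction t t' s U).tiGroundEnergyDensityAt 2 ρ ≤
      R + |s| * (V * ((R - L') / (U - U')) - ℓ) := by
  have hU : 0 ≤ U := hU'.trans hU'U.le
  obtain ⟨ψ, φ, ω, -, -, -, -, hTI, -, hdens, he⟩ :=
    exists_isTorusLimitOf_meanEnergy_hubbardTTPrime_eq t t' hU hρ0.le hρ2 tendsto_id
  -- the supergradient chord: `(U − U')·D(ω) ≤ e(U) − e(U') ≤ R − L'`
  have haff := ω.meanEnergy_hubbardTTPrime_affine t t' U t' U'
  have hvar := InfVolFermionState.energyDensityTT'_le_meanEnergy_of_isTranslationInvariant t t' hU' hρ0 hρ2 hTI hdens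
  rw [haff, he, sub_self, zero_mul, add_zero] at hvar
  have hgap : 0 < U - U' := sub_pos.2 hU'U
  have hD : ω.meanEnergy (hubbardTTPrimeFermionInteraction 0 0 1) 1 ≤ (R - L') / (U - U') := by
    rw [le_div_iff₀ hgap]
    nlinarith
  exact tpp_le_cap_add_abs_mul_diagU t t' s U hρ0 hρ2 hTI hdens (by rw [he]; exact hR) hD hV hℓ

/-- **`t''`-INTERVAL cap form**: for `|s| ≤ m` and `0 ≤ V·D − ℓ` the dressed cap reads `e_ρ(t,t',s,U) ≤ R + m·(V·D − ℓ)`.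
[cite: Griffiths1966, §II] -/
theorem tpp_le_cap_add_mul_diagU_of_abs_le (t t' : ℝ) {s m : ℝ} (hsm : |s| ≤ m) {U : ℝ} (hU : 0 ≤ U) {ρ : ℝ}
    (hρ0 : 0 < ρ) (hρ2 : ρ < 2) {R : ℝ} (hR : energyDensityTT' t t' U ρ ≤ R) {D : ℝ}
    (hD : ∀ (ω : InfVolFermionState 2) (Ls : ℕ → ℕ) (ψ : ∀ L, Fock (Orb (FermionTorus 2 L))),
      Tendsto Ls atTop atTop →
      (∀ j, IsGroundStateInSector (hubbardTorusTT' (Ls j) t t' U) (rectN ρ (Ls j)) 0 (ψ (Ls j))) →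
      (∀ j, star (ψ (Ls j)) ⬝ᵥ ψ (Ls j) = 1) → ω.IsTorusLimitOf ψ Ls →
      ω.meanEnergy (hubbardTTPrimeFermionInteraction 0 0 1) 1 ≤ D)
    {V : ℝ} (hV : 0 ≤ V) {ℓ : ℝ} (hℓ : ℓ ≤ energyDensityTT' 1 0 V ρ) (hDℓ : 0 ≤ V * D - ℓ) :
    (hubbardTT'T''FermionInteraction t t' s U).tiGroundEnergyDensityAt 2 ρ ≤ R + m * (V * D - ℓ) := by
  have h := tpp_le_cap_add_abs_mul_diagU_of_forall_docc t t' s hU hρ0 hρ2 hR hD hV hℓ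
  have hm : |s| * (V * D - ℓ) ≤ m * (V * D - ℓ) := mul_le_mul_of_nonneg_right hsm hDℓ
  linarith

/-! ### §5. Object-M box words -/

/-- **DRESSED OBJECT-M FLOOR ON A BOX.** A CONSTANT `t–t'` floor `L` on the anchor column `U = U_a ≥ 0` over
`t' ∈ [s₁,s₂]`, `n ∈ [n₁,n₂]` (`0 < n₁`, `n₂ < 2`) — e.g. the bottom face of a certified cell word — and a
non-positive `t' = 0` row `ℓ ≤ e(1, 0, V, n)` valid for every `n ∈ [n₁,n₂]` (`V ≥ 0`) give, on the whole object-M box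
`U ∈ [U₁,U₂]`, `t' ∈ [s₁,s₂]`, `t'' ∈ [p₁,p₂]`, `n ∈ [n₁,n₂]` with `U_a + max(|p₁|,|p₂|)·V ≤ U₁`:
`L + max(|p₁|,|p₂|)·ℓ ≤ e_n(t, t', t'', U)` — the dressed replacement of the seam's `L − (16/π²)·max|t''|`.
[cite: Ruelle1969, §3.4] -/
theorem le_tpp_on_box_of_anchorFloor_diagU (t : ℝ) {U₁ U₂ s₁ s₂ p₁ p₂ n₁ n₂ Ua V L ℓ : ℝ} (hUa : 0 ≤ Ua)
    (hV : 0 ≤ V) (hUaU : Ua + max |p₁| |p₂| * V ≤ U₁) (hn₁ : 0 < n₁) (hn₂ : n₂ < 2)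
    (hL : ∀ s' ∈ Set.Icc s₁ s₂, ∀ n ∈ Set.Icc n₁ n₂, L ≤ energyDensityTT' t s' Ua n)
    (hℓ : ∀ n ∈ Set.Icc n₁ n₂, ℓ ≤ energyDensityTT' 1 0 V n) (hℓ0 : ℓ ≤ 0) :
    ∀ U ∈ Set.Icc U₁ U₂, ∀ s' ∈ Set.Icc s₁ s₂, ∀ p ∈ Set.Icc p₁ p₂, ∀ n ∈ Set.Icc n₁ n₂,
      L + max |p₁| |p₂| * ℓ ≤ (hubbardTT'T''FermionInteraction t s' p U).tiGroundEnergyDensityAt 2 n := by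
  intro U hU s' hs' p hp n hn
  exact le_tpp_of_anchorFloor_diagU_of_abs_le t s' (abs_le_max_abs_abs hp.1 hp.2) hUa hV (hUaU.trans hU.1)
    (hn₁.trans_le hn.1) (hn.2.trans_lt hn₂) (hL s' hs' n hn) (hℓ n hn) hℓ0

/-- **DRESSED OBJECT-M CAP ON A BOX.** A CONSTANT `t–t'` cap `R` on the cell `[U₁,U₂] × [s₁,s₂] × [n₁,n₂]`
(`0 ≤ U₁`, `0 < n₁`, `n₂ < 2`), a double-occupancy ceiling `D` for every torus-limit ground state of the cell, a row
`ℓ ≤ e(1, 0, V, n)` on `[n₁,n₂]` (`V ≥ 0`, `0 ≤ V·D − ℓ`) give, on the object-M box with `t'' ∈ [p₁,p₂]`: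
`e_n(t, t', t'', U) ≤ R + max(|p₁|,|p₂|)·(V·D − ℓ)`. [cite: Griffiths1966, §II] -/
theorem tpp_le_on_box_of_cap_docc_diagU (t : ℝ) {U₁ U₂ s₁ s₂ p₁ p₂ n₁ n₂ V R D ℓ : ℝ} (hU₁ : 0 ≤ U₁)
    (hV : 0 ≤ V) (hn₁ : 0 < n₁) (hn₂ : n₂ < 2)
    (hR : ∀ U ∈ Set.Icc U₁ U₂, ∀ s' ∈ Set.Icc s₁ s₂, ∀ n ∈ Set.Icc n₁ n₂, energyDensityTT' t s' U n ≤ R)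
    (hD : ∀ U ∈ Set.Icc U₁ U₂, ∀ s' ∈ Set.Icc s₁ s₂, ∀ n ∈ Set.Icc n₁ n₂,
      ∀ (ω : InfVolFermionState 2) (Ls : ℕ → ℕ) (ψ : ∀ L, Fock (Orb (FermionTorus 2 L))),
      Tendsto Ls atTop atTop →
      (∀ j, IsGroundStateInSector (hubbardTorusTT' (Ls j) t s' U) (rectN n (Ls j)) 0 (ψ (Ls j))) →
      (∀ j, star (ψ (Ls j)) ⬝ᵥ ψ (Ls j) = 1) → ω.IsTorusLimitOf ψ Ls →
      ω.meanEnergy (hubbardTTPrimeFermionInteraction 0 0 1) 1 ≤ D)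
    (hℓ : ∀ n ∈ Set.Icc n₁ n₂, ℓ ≤ energyDensityTT' 1 0 V n) (hDℓ : 0 ≤ V * D - ℓ) :
    ∀ U ∈ Set.Icc U₁ U₂, ∀ s' ∈ Set.Icc s₁ s₂, ∀ p ∈ Set.Icc p₁ p₂, ∀ n ∈ Set.Icc n₁ n₂,
      (hubbardTT'T''FermionInteraction t s' p U).tiGroundEnergyDensityAt 2 n ≤ R + max |p₁| |p₂| * (V * D - ℓ) := by
  intro U hU s' hs' p hp n hn
  exact tpp_le_cap_add_mul_diagU_of_abs_le t s' (abs_le_max_abs_abs hp.1 hp.2) (hU₁.trans hU.1)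
    (hn₁.trans_le hn.1) (hn.2.trans_lt hn₂) (hR U hU s' hs' n hn) (hD U hU s' hs' n hn) hV (hℓ n hn) hDℓ

/-- **THE DRESSED OBJECT-M WINDOW ON A BOX** (both sides; the replacement of
`tiGroundEnergyDensityAt_tpp_mem_Icc_kinematic` for a whole object-M box): with the data of
`le_tpp_on_box_of_anchorFloor_diagU` (floor read at the anchor column `U_a`, row `ℓ` at coupling `V`) and of
`tpp_le_on_box_of_cap_docc_diagU` (cell cap `R`, cell docc ceiling `D`, row `ℓ'` at coupling `V'`):
`e_n(t,t',t'',U) ∈ [L + m·ℓ, R + m·(V'·D − ℓ')]`, `m = max(|p₁|,|p₂|)`. [cite: Ruelle1969, §3.4] [cite: Griffiths1966, §II] -/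
theorem tpp_mem_Icc_on_box_diagU (t : ℝ) {U₁ U₂ s₁ s₂ p₁ p₂ n₁ n₂ Ua V V' L R D ℓ ℓ' : ℝ} (hUa : 0 ≤ Ua)
    (hV : 0 ≤ V) (hV' : 0 ≤ V') (hUaU : Ua + max |p₁| |p₂| * V ≤ U₁) (hU₁ : 0 ≤ U₁) (hn₁ : 0 < n₁)
    (hn₂ : n₂ < 2) (hL : ∀ s' ∈ Set.Icc s₁ s₂, ∀ n ∈ Set.Icc n₁ n₂, L ≤ energyDensityTT' t s' Ua n)
    (hℓ : ∀ n ∈ Set.Icc n₁ n₂, ℓ ≤ energyDensityTT' 1 0 V n) (hℓ0 : ℓ ≤ 0)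
    (hR : ∀ U ∈ Set.Icc U₁ U₂, ∀ s' ∈ Set.Icc s₁ s₂, ∀ n ∈ Set.Icc n₁ n₂, energyDensityTT' t s' U n ≤ R)
    (hD : ∀ U ∈ Set.Icc U₁ U₂, ∀ s' ∈ Set.Icc s₁ s₂, ∀ n ∈ Set.Icc n₁ n₂,
      ∀ (ω : InfVolFermionState 2) (Ls : ℕ → ℕ) (ψ : ∀ L, Fock (Orb (FermionTorus 2 L))),
      Tendsto Ls atTop atTop →
      (∀ j, IsGroundStateInSector (hubbardTorusTT' (Ls j) t s' U) (rectN n (Ls j)) 0 (ψ (Ls j))) →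
      (∀ j, star (ψ (Ls j)) ⬝ᵥ ψ (Ls j) = 1) → ω.IsTorusLimitOf ψ Ls →
      ω.meanEnergy (hubbardTTPrimeFermionInteraction 0 0 1) 1 ≤ D)
    (hℓ' : ∀ n ∈ Set.Icc n₁ n₂, ℓ' ≤ energyDensityTT' 1 0 V' n) (hDℓ' : 0 ≤ V' * D - ℓ') :
    ∀ U ∈ Set.Icc U₁ U₂, ∀ s' ∈ Set.Icc s₁ s₂, ∀ p ∈ Set.Icc p₁ p₂, ∀ n ∈ Set.Icc n₁ n₂,
      (hubbardTT'T''FermionInteraction t s' p U).tiGroundEnergyDensityAt 2 n ∈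
        Set.Icc (L + max |p₁| |p₂| * ℓ) (R + max |p₁| |p₂| * (V' * D - ℓ')) :=
  fun U hU s' hs' p hp n hn =>
    ⟨le_tpp_on_box_of_anchorFloor_diagU t hUa hV hUaU hn₁ hn₂ hL hℓ hℓ0 U hU s' hs' p hp n hn,
      tpp_le_on_box_of_cap_docc_diagU t hU₁ hV' hn₁ hn₂ hR hD hℓ' hDℓ' U hU s' hs' p hp n hn⟩

end Literature.MathematicalPhysics.QuantumLattice

end
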